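import Literature.RingTheory.FormalGroups.LazardLifting
import HarnessLib

/-!
# Crux `HLiu418` — P6 «MOD programme» SUB-LINE F0-P6d LubinTateFormalModuli, HEAD `stub_L4B3c_holds : FormalGroupLiftsAlongSurjection p`
# (TIER I, the Lubin–Tate heart of Row 4's smoothness) — directly by LAZARD (lifting of commutative laws along surjections)

HC_CM is proved only modulo the printed citations until rung 0 closes.  Cell `hodgecm-mathlib`, floor 0, programme P6, sub-line
skeleton `Cruxes/HLiu418/Lines/F0_P6d_LubinTateFormalModuli.lean` (F0P6d-plan (g0), ED. 2), head
`theorem stub_L4B3c_holds (p : ℕ) [Fact p.Prime] : FormalGroupLiftsAlongSurjection.{u} p` (there derived from the stubs (c0) +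
(c1)).  This file proves `formalGroupLiftsAlongSurjection_holds`, whose statement is the body of `FormalGroupLiftsAlongSurjection p`
BINDER FOR BINDER (nothing imports the Lines module), for EVERY `p : ℕ` and WITHOUT the stubs: it is ★
`Literature.RingTheory.FormalGroups.exists_formalGroup_map_eq_of_surjective` (file `LazardLifting`: Lazard's theorem
`L ≅ ℤ[T]` ⇒ lift the classifying map by freeness).  Fold: `stub_L4B3c_holds p := formalGroupLiftsAlongSurjection_holds p`
(the `Fact p.Prime` instance and the hypothesis `IsNilpotent (p : A′)` are idle).  THEOREMS ONLY; no definition, no instance,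
no `sorry`.

## References
* [Lazard1955] M. Lazard, *Sur les groupes de Lie formels à un paramètre*, Bull. SMF 83 (1955), Théorèmes II–III (pp. 254–255).
-/

set_option autoImplicit false
set_option linter.dupNamespace false -- the mandated namespace repeats `HodgeConjecture.HodgeConjecture`

noncomputable section

namespace Summit.HodgeConjecture.HodgeConjecture.Cruxes.HLiu418.F0P6dLubinTateHeadL4B3c

universe u

/-- **HEAD `stub_L4B3c_holds : FormalGroupLiftsAlongSurjection p` of `Lines/F0_P6d_LubinTateFormalModuli.lean` — its body BINDER
FOR BINDER, for EVERY `p : ℕ`**: for `π : A′ ↠ A` surjective (and `p` nilpotent in `A′`, idle) every commutative one-dimensional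
formal group law `G` over `A` lifts to a commutative law `G′` over `A′` with `G′.map π = G` (Lazard).
Fold: `stub_L4B3c_holds p := formalGroupLiftsAlongSurjection_holds p`. [cite: Lazard1955, Théorème III (p. 255)] -/
theorem formalGroupLiftsAlongSurjection_holds (p : ℕ) :
    ∀ (A' A : Type u) [CommRing A'] [CommRing A] (π : A' →+* A), Function.Surjective π → IsNilpotent (p : A') →
      ∀ (G : FormalGroup A), G.IsComm → ∃ G' : FormalGroup A', G'.IsComm ∧ G'.map π = G :=
  fun A' A _ _ π hπ hp G hG =>
    Literature.RingTheory.FormalGroups.formalGroup_liftsAlongSurjection p A' A π hπ hp G hG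

/-- The same for a prime `p` with the `Fact p.Prime` instance of the registered head (idle). [cite: Lazard1955, Théorème III (p. 255)] -/
theorem formalGroupLiftsAlongSurjection_holds_of_prime (p : ℕ) [Fact p.Prime] :
    ∀ (A' A : Type u) [CommRing A'] [CommRing A] (π : A' →+* A), Function.Surjective π → IsNilpotent (p : A') →
      ∀ (G : FormalGroup A), G.IsComm → ∃ G' : FormalGroup A', G'.IsComm ∧ G'.map π = G :=
  formalGroupLiftsAlongSurjection_holds p

end Summit.HodgeConjecture.HodgeConjecture.Cruxes.HLiu418.F0P6dLubinTateHeadL4B3c
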